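import Mathlib
import Literature.Computability.AlgebraicComplexity.MS21AffineOrbitCoefficientMap
import Literature.Computability.AlgebraicComplexity.MS21ContinuantHittingSetProofs
import HarnessLib

/-!
# Medini–Shpilka 2021, Thm 30 (existence and size, as typed): interpolating sets for the affine
# orbits of the continuants — and the difference-class hitting lemma for affine orbits

Sequel of `MS21AffineOrbitCoefficientMap.lean`. An INTERPOLATING set for a class `𝒞` is a set of
points on which no two distinct members of `𝒞` agree (`HittingSets.IsInterpolatingSetFor`), i.e. a
hitting set for the difference class `𝒞 - 𝒞`. For affine orbits the differences
`g(Ax + b) - g'(A'x + b')` are again values of a polynomial map, now in the `2(n² + n)` entries of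
`(A, b, A', b')`, with coefficient-degree `≤ max(deg g, deg g')` — so the coefficient-cover engine
(`CoeffCover.exists_hittingSet`, Heintz–Schnorr type) applies verbatim:

* `MS2021.AffineOrbitCoeff.exists_hittingSet_affOrbit_sub` — for `g, g'` of degree `≤ d` and a
  nonempty grid `S`, `|S| ≥ 2d`, some `H ⊆ Sⁿ` with `|H| ≤ (2(n·n+n))(log₂(|S|ⁿ d + 1) + 1) + 1` hits
  every nonzero `f - f'`, `f ∈ g^{GLaff_n}`, `f' ∈ g'^{GLaff_n}`;
* `MS2021_thm_30_holds : MS2021_thm_30` — MS Thm 30 (CCC 2021 LIPIcs 200:19 p.19:12 = arXiv Thm 1.18)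
  AS TYPED (existence and size only, "explicit" dropped): with `c = 17`, over every field with
  `|F| ≥ n²` (or infinite) an interpolating set of `≤ 17·n⁶ ≤ 17·n¹⁰` points for
  `⋃_{1 ≤ m ≤ n} C_m^{GLaff_n(F)}` (union over the `n²` pairs `(m, m')` of the sets above on a
  `2n`-grid, `deg C_m ≤ m ≤ n` from `MS2021.totalDegree_cont_le` of `MS21ContinuantHittingSetProofs.lean`).

Disclosed deviation: existence by parametrisation + coefficient cover instead of the printed explicit
generator (Thm 28 for differences + [23]); this is exactly the weaker content of the tree's statement.
Theorem-only file; no definitions, no new named facts. `VP ≠ VNP` is NOT proved and nothing here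
bears on it.

## References
* [MediniShpilka2021] D. Medini, A. Shpilka, CCC 2021, LIPIcs 200:19, Thm 30 (p.19:12; = arXiv
  Thm 1.18, p0007:L80-L83); §1.1.6 eq. (2); Cor 29.
* J. Heintz, C.-P. Schnorr, STOC 1980, Thm 4.4 (coefficient-cover engine).
-/

noncomputable section

open MvPolynomial

namespace Literature.Computability.AlgebraicComplexity

open HittingSets

namespace MS2021

namespace AffineOrbitCoeff

variable {K : Type*} [Field K]

/-- **Hitting the difference class of two affine orbits by coefficient cover.** For `g ∈ F[x_1..x_m]`,
`g' ∈ F[x_1..x_{m'}]` of degree `≤ d` (`m, m' ≤ n`) and a nonempty grid `S ⊆ F` with `|S| ≥ 2d`,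
some `H ⊆ Sⁿ` with `|H| ≤ (n·n + n + (n·n + n))(log₂(|S|ⁿ·d + 1) + 1) + 1` hits every nonzero
difference `f - f'`, `f ∈ g^{GLaff_n}`, `f' ∈ g'^{GLaff_n}` (parameters `(A, b, A', b')`).
[cite: MediniShpilka2021, Thm 30 / Cor 36 (CCC p.19:12-13; existence of poly-size interpolating sets for affine orbits)] -/
theorem exists_hittingSet_affOrbit_sub {m m' n d : ℕ} (h : m ≤ n) (h' : m' ≤ n)
    (g : MvPolynomial (Fin m) K) (g' : MvPolynomial (Fin m') K) (hg : g.totalDegree ≤ d)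
    (hg' : g'.totalDegree ≤ d) (S : Finset K) (hS1 : S.Nonempty) (hS : 2 * d ≤ S.card) :
    ∃ H : Finset (Fin n → K), (∀ a ∈ H, ∀ i, a i ∈ S) ∧
      H.card ≤ (n * n + n + (n * n + n)) * (Nat.log 2 (S.card ^ n * d + 1) + 1) + 1 ∧
      ∀ f ∈ affOrbit n g, ∀ f' ∈ affOrbit n g', f - f' ≠ 0 → ∃ a ∈ H, eval a (f - f') ≠ 0 := by
  classical
  -- the coefficient polynomials of the difference, in `2(n·n+n)` parameters
  let Gm : {μ : Fin n →₀ ℕ | μ.degree ≤ d} → MvPolynomial (Fin (n * n + n + (n * n + n))) K :=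
    fun μ => rename (Fin.castAdd (n * n + n)) (coeffPoly h g μ) -
      rename (Fin.natAdd (n * n + n)) (coeffPoly h' g' μ)
  have hGm : ∀ μ, (Gm μ).totalDegree ≤ d := by
    intro μ
    refine (totalDegree_sub _ _).trans (max_le ?_ ?_)
    · exact (totalDegree_rename_le _ _).trans ((totalDegree_coeffPoly_le h g μ).trans hg)
    · exact (totalDegree_rename_le _ _).trans ((totalDegree_coeffPoly_le h' g' μ).trans hg')
  obtain ⟨H, hHS, hHcard, hhit⟩ := CoeffCover.exists_hittingSet (F := K) n d
    (n * n + n + (n * n + n)) d (Finsupp.finite_of_degree_le (σ := Fin n) d) Gm hGm S hS1 hS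
  refine ⟨H, hHS, hHcard, fun f hf f' hf' hne => ?_⟩
  obtain ⟨h₁, A, b, -, rfl⟩ := hf
  obtain ⟨h₂, A', b', -, rfl⟩ := hf'
  have hdeg : (affSubst h₁ A b g - affSubst h₂ A' b' g').totalDegree ≤ d :=
    (totalDegree_sub _ _).trans (max_le ((totalDegree_affSubst_le h₁ A b g).trans hg)
      ((totalDegree_affSubst_le h₂ A' b' g').trans hg'))
  refine hhit _ hdeg ⟨Fin.append (params n A b) (params n A' b'), fun μ => ?_⟩ hne
  have hl : (Fin.append (params n A b) (params n A' b') ∘ Fin.castAdd (n * n + n)) =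
      params n A b := funext fun l => Fin.append_left _ _ l
  have hr : (Fin.append (params n A b) (params n A' b') ∘ Fin.natAdd (n * n + n)) =
      params n A' b' := funext fun l => Fin.append_right _ _ l
  simp only [Gm, map_sub, eval_rename, hl, hr, eval_coeffPoly, coeff_sub]

/-- A hitting set for all differences is an interpolating set. [cite: MediniShpilka2021, §1.1.5 (interpolating sets vs hitting sets for differences; CCC p.19:8)] -/
theorem isInterpolatingSetFor_of_hits_sub {n : ℕ} (H : Set (Fin n → K))
    (𝒞 : Set (MvPolynomial (Fin n) K))
    (hH : ∀ f ∈ 𝒞, ∀ f' ∈ 𝒞, f - f' ≠ 0 → ∃ a ∈ H, eval a (f - f') ≠ 0) :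
    IsInterpolatingSetFor H 𝒞 := by
  intro f hf f' hf' hagree
  by_contra hne
  obtain ⟨a, ha, hfa⟩ := hH f hf f' hf' (sub_ne_zero.mpr hne)
  exact hfa (by rw [map_sub, hagree a ha, sub_self])

end AffineOrbitCoeff

namespace Thm30

variable {K : Type*} [Field K]

/-- **Interpolating set for `⋃_{1 ≤ m ≤ n} C_m^{GLaff_n}` on a grid**: for a nonempty grid `S` with
`|S| ≥ 2n`, some `H` with `|H| ≤ n² · ((2(n·n+n))(log₂(|S|ⁿ·n + 1) + 1) + 1)` is interpolating for
`contOrbits K n`. [cite: MediniShpilka2021, Thm 30 (CCC p.19:12; existence and size)] -/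
theorem exists_interpolatingSet_contOrbits_grid (n : ℕ) (S : Finset K) (hS1 : S.Nonempty)
    (hS : 2 * n ≤ S.card) :
    ∃ H : Finset (Fin n → K),
      H.card ≤ (n * n) * ((n * n + n + (n * n + n)) * (Nat.log 2 (S.card ^ n * n + 1) + 1) + 1) ∧
      IsInterpolatingSetFor (↑H : Set (Fin n → K)) (contOrbits K n) := by
  classical
  have hdeg : ∀ k : Fin n, (cont K ((k : ℕ) + 1)).totalDegree ≤ n :=
    fun k => (totalDegree_cont_le K ((k : ℕ) + 1)).trans (by omega)
  have hex : ∀ kk : Fin n × Fin n, ∃ H : Finset (Fin n → K), (∀ a ∈ H, ∀ i, a i ∈ S) ∧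
      H.card ≤ (n * n + n + (n * n + n)) * (Nat.log 2 (S.card ^ n * n + 1) + 1) + 1 ∧
      ∀ f ∈ affOrbit n (cont K ((kk.1 : ℕ) + 1)), ∀ f' ∈ affOrbit n (cont K ((kk.2 : ℕ) + 1)),
        f - f' ≠ 0 → ∃ a ∈ H, eval a (f - f') ≠ 0 :=
    fun kk => AffineOrbitCoeff.exists_hittingSet_affOrbit_sub (n := n) (d := n) (by omega)
      (by omega) _ _ (hdeg kk.1) (hdeg kk.2) S hS1 hS
  choose H _hHS hHcard hhit using hex
  refine ⟨Finset.univ.biUnion H, ?_, ?_⟩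
  · calc (Finset.univ.biUnion H).card ≤ ∑ kk : Fin n × Fin n, (H kk).card := Finset.card_biUnion_le
      _ ≤ ∑ _kk : Fin n × Fin n,
            ((n * n + n + (n * n + n)) * (Nat.log 2 (S.card ^ n * n + 1) + 1) + 1) :=
          Finset.sum_le_sum fun kk _ => hHcard kk
      _ = (n * n) * ((n * n + n + (n * n + n)) * (Nat.log 2 (S.card ^ n * n + 1) + 1) + 1) := by
          simp
  · refine AffineOrbitCoeff.isInterpolatingSetFor_of_hits_sub _ _ fun f hf f' hf' hne => ?_
    obtain ⟨m, hm1, hmn, hfm⟩ := hf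
    obtain ⟨m', hm1', hmn', hfm'⟩ := hf'
    obtain ⟨k, rfl⟩ : ∃ k, m = k + 1 := ⟨m - 1, by omega⟩
    obtain ⟨k', rfl⟩ : ∃ k', m' = k' + 1 := ⟨m' - 1, by omega⟩
    obtain ⟨a, ha, hfa⟩ := hhit (⟨k, by omega⟩, ⟨k', by omega⟩) f hfm f' hfm' hne
    exact ⟨a, Finset.mem_coe.mpr (Finset.mem_biUnion.mpr ⟨_, Finset.mem_univ _, ha⟩), hfa⟩

/-- The size arithmetic: with `|S| = 2n` (`n ≥ 1`),
`n² · ((2(n² + n))(log₂((2n)ⁿ n + 1) + 1) + 1) ≤ 17 n⁶`. [folklore] -/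
private theorem size_bound (n : ℕ) (hn : 1 ≤ n) :
    (n * n) * ((n * n + n + (n * n + n)) * (Nat.log 2 ((2 * n) ^ n * n + 1) + 1) + 1) ≤
      17 * n ^ 6 := by
  have h2n : 2 * n ≤ 2 ^ (n + 1) := by
    have := (Nat.lt_two_pow_self (n := n)).le
    rw [pow_succ]; omega
  have hpow : (2 * n) ^ n * n + 1 < 2 ^ (n * n + 2 * n + 1) := by
    have h1 : (2 * n) ^ n ≤ 2 ^ ((n + 1) * n) := by
      rw [pow_mul]; exact Nat.pow_le_pow_left h2n n
    have h2 : n ≤ 2 ^ n := (Nat.lt_two_pow_self (n := n)).le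
    have h3 : (2 * n) ^ n * n ≤ 2 ^ (n * n + 2 * n) := by
      calc (2 * n) ^ n * n ≤ 2 ^ ((n + 1) * n) * 2 ^ n := Nat.mul_le_mul h1 h2
        _ = 2 ^ (n * n + 2 * n) := by rw [← pow_add]; ring_nf
    have h4 : 1 < 2 ^ (n * n + 2 * n) := Nat.one_lt_two_pow (by nlinarith)
    rw [pow_succ]; omega
  have hlog : Nat.log 2 ((2 * n) ^ n * n + 1) + 1 ≤ n * n + 2 * n + 1 := by
    have := Nat.log_lt_of_lt_pow (by positivity) hpow
    omega
  have hn1 : n ≤ n ^ 4 := by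
    calc n = n ^ 1 := (pow_one n).symm
      _ ≤ n ^ 4 := Nat.pow_le_pow_right hn (by norm_num)
  have hn2 : n ^ 2 ≤ n ^ 4 := Nat.pow_le_pow_right hn (by norm_num)
  have hn3 : n ^ 3 ≤ n ^ 4 := Nat.pow_le_pow_right hn (by norm_num)
  have hn4 : 1 ≤ n ^ 4 := Nat.one_le_pow _ _ hn
  have hinner : (n * n + n + (n * n + n)) * (Nat.log 2 ((2 * n) ^ n * n + 1) + 1) + 1 ≤
      17 * n ^ 4 := by
    calc (n * n + n + (n * n + n)) * (Nat.log 2 ((2 * n) ^ n * n + 1) + 1) + 1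
        ≤ (n * n + n + (n * n + n)) * (n * n + 2 * n + 1) + 1 :=
          Nat.add_le_add_right (Nat.mul_le_mul_left _ hlog) 1
      _ = 2 * n ^ 4 + 6 * n ^ 3 + 6 * n ^ 2 + 2 * n + 1 := by ring
      _ ≤ 17 * n ^ 4 := by linarith
  calc (n * n) * ((n * n + n + (n * n + n)) * (Nat.log 2 ((2 * n) ^ n * n + 1) + 1) + 1)
      ≤ (n * n) * (17 * n ^ 4) := Nat.mul_le_mul_left _ hinner
    _ = 17 * n ^ 6 := by ring

end Thm30

end MS2021

/-- **MS Thm 30 (`MS2021_thm_30`, existence and size as typed), DISCHARGED** with `c = 17`: over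
every field with `|F| ≥ n²` (or infinite) some set of at most `17·n¹⁰` (indeed `17·n⁶`) points is an
interpolating set for `⋃_{1 ≤ m ≤ n} C_m^{GLaff_n(F)}`. Route (disclosed): parametrisation of the
differences + coefficient cover (`MS2021.AffineOrbitCoeff.exists_hittingSet_affOrbit_sub`), not the
explicit generator of the printed proof.
[cite: MediniShpilka2021, Thm 30 (CCC 2021 LIPIcs 200:19, p.19:12; = arXiv:2102.05632 Thm 1.18, p0007:L80-L83)] -/
theorem MS2021_thm_30_holds : MS2021_thm_30 := by
  classical
  refine ⟨17, fun K _ n hK => ?_⟩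
  rcases Nat.eq_zero_or_pos n with rfl | hn
  · refine ⟨∅, by simp, ?_⟩
    rintro f ⟨m, hm1, hm0, -⟩
    omega
  -- a grid of exactly `2n` field elements
  have hS : ∃ S : Finset K, S.card = 2 * n := by
    by_cases hinf : Infinite K
    · exact Infinite.exists_subset_card_eq K (2 * n)
    · haveI : Fintype K := fintypeOfNotInfinite hinf
      have hcard : n ^ 2 ≤ Nat.card K := hK.resolve_left hinf
      have h2 : 2 * n ≤ (Finset.univ : Finset K).card := by
        rw [Finset.card_univ]
        rcases Nat.lt_or_ge n 2 with hlt | hge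
        · have : 1 < Fintype.card K := Fintype.one_lt_card
          omega
        · have : n ^ 2 ≤ Fintype.card K := by rwa [Nat.card_eq_fintype_card] at hcard
          nlinarith
      obtain ⟨S, -, hS⟩ := Finset.exists_subset_card_eq h2
      exact ⟨S, hS⟩
  obtain ⟨S, hScard⟩ := hS
  have hS1 : S.Nonempty := Finset.card_pos.mp (by omega)
  obtain ⟨H, hHcard, hint⟩ :=
    MS2021.Thm30.exists_interpolatingSet_contOrbits_grid (K := K) n S hS1 (by omega)
  refine ⟨H, hHcard.trans ?_, hint⟩
  rw [hScard]
  exact (MS2021.Thm30.size_bound n hn).trans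
    (Nat.mul_le_mul_left 17 (Nat.pow_le_pow_right hn (by norm_num)))

end Literature.Computability.AlgebraicComplexity

end
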